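import Summits.QuantumFields.YangMills.Theorems.AllWindowsColdBoxBoxHighLineTiltNormTransfer
import Summits.QuantumFields.YangMills.Theorems.AllWindowsColdBoxBoxHighLineGaussianSmallFieldTail
import Summits.QuantumFields.YangMills.Theorems.AllWindowsColdBoxBoxHighLineEdgeChartMoments

/-!
# T-S5.13n (n5) «TiltNormTransferGauss» — the tilted expectations over `μ_D = 1_D·e^{−β·boxQuadForm} da` in `gaussAvg` letters

Companion of ✓`…TiltNormTransfer` (n1–n4) for the assembler of `stub_landauSecondOrder` (ASSEMBLY-S5 §6; planner ym-idea-2 g18 20:16:53Z: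
«μ_D := (volume.restrict (smallField H s)).withDensity (ofReal ∘ gaussWeight β H) — exactly the assembler's measure»):

* `Tilt.integral_muD_eq` — `∫ F dμ_D = ∫ sfInd H s · (F · gaussWeight β H)` (density + restriction unfolded);
  `Tilt.muD_univ_toReal`, `Tilt.isFiniteMeasure_muD`, `Tilt.neZero_muD` (from `0 < ∫ sfInd·gaussWeight`), `Tilt.ae_muD_mem_smallField`;
* `Tilt.tiltExp_muD_eq_ratio` — `E_t[G] = gaussAvg β H (sfInd·G·e^{tU}) / gaussAvg β H (sfInd·e^{tU})`;
* ★ `Tilt.tiltExp_muD_le_gaussAvg` — NORM TRANSFER in `gaussAvg` letters: for `0 ≤ G` with `G·gaussWeight` integrable, `|U| ≤ B` on `smallField H s`,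
  `0 ≤ t`:  `E_t[G] ≤ e^{2tB} · gaussAvg β H (sfInd H s · G) / gaussAvg β H (sfInd H s)` (and the lower version `…_ge_gaussAvg`).

Tree + Mathlib; no definitions.  HONEST LABEL: plumbing for T-S5.13 of the XL stub S5 (LINE-19 ⟨stmt-QuantumFields-24004⟩/⟨24335⟩) on a critic-PASSed
DRAFT line; 13, S5, U5, ⟨24004⟩ ⟨24335⟩ ⟨24336⟩ remain OPEN; **the Yang–Mills mass gap is NOT proved by this file; no summit is proved by a line.**
Seat ym-line-sfw-p2-w5 g22 (EXTRA WIDTH seat w5, cell ym-idea-1).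
-/

set_option autoImplicit false

noncomputable section

open MeasureTheory Set
open scoped ENNReal

namespace Summit.QuantumFields.YangMills.Theorems.AllWindowsColdBoxBoxHighLine

namespace Tilt

variable (H : ℕ)

/-! ## The measure `μ_D = (volume.restrict (smallField H s)).withDensity (ofReal ∘ gaussWeight β H)` -/

/-- `∫ F dμ_D = ∫ sfInd H s · (F · gaussWeight β H)` (any `F`; `β > 0`). -/
theorem integral_muD_eq {β : ℝ} (hβ : 0 < β) (s : ℝ) (F : (LandauFree H → E3) → ℝ) :
    ∫ a, F a ∂((volume.restrict (smallField H s)).withDensity fun a => ENNReal.ofReal (gaussWeight β H a)) =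
      ∫ a, sfInd H s a * (F a * gaussWeight β H a) := by
  have hw : AEMeasurable (fun a : LandauFree H → E3 => ENNReal.ofReal (gaussWeight β H a)) (volume.restrict (smallField H s)) :=
    (EdgeChartGaussian.aestronglyMeasurable_gaussWeight H hβ).aemeasurable.ennreal_ofReal.restrict
  rw [integral_withDensity_eq_integral_toReal_smul₀ hw (Filter.Eventually.of_forall fun _ => ENNReal.ofReal_lt_top) F]
  simp only [ENNReal.toReal_ofReal (EdgeChartGaussian.gaussWeight_pos β H _).le, smul_eq_mul]
  rw [← integral_indicator (ChartGauss.measurableSet_smallField s)]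
  refine integral_congr_ae (Filter.Eventually.of_forall fun a => ?_)
  by_cases ha : a ∈ smallField H s
  · simp only [Set.indicator_of_mem ha, sfInd, one_mul, mul_comm]
  · simp only [Set.indicator_of_notMem ha, sfInd, zero_mul]

/-- `μ_D(Ω) = ∫ sfInd · gaussWeight`. -/
theorem muD_univ_toReal {β : ℝ} (hβ : 0 < β) (s : ℝ) :
    ((volume.restrict (smallField H s)).withDensity fun a => ENNReal.ofReal (gaussWeight β H a)).real univ =
      ∫ a, sfInd H s a * gaussWeight β H a := by
  have h := integral_muD_eq H hβ s fun _ => (1 : ℝ)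
  simp only [one_mul, integral_const, smul_eq_mul, mul_one] at h
  exact h

/-- `μ_D` is a finite measure. -/
theorem isFiniteMeasure_muD {β : ℝ} (hβ : 0 < β) (s : ℝ) :
    IsFiniteMeasure ((volume.restrict (smallField H s)).withDensity fun a => ENNReal.ofReal (gaussWeight β H a)) :=
  isFiniteMeasure_withDensity_ofReal (EdgeChartGaussian.integrable_gaussWeight H hβ).restrict.hasFiniteIntegral

/-- `μ_D ≠ 0` as soon as `∫ sfInd · gaussWeight > 0` (e.g. `E₀[1_D] ≥ 1/2` by ✓T-S5.6g). -/
theorem neZero_muD {β : ℝ} (hβ : 0 < β) {s : ℝ} (hD : 0 < ∫ a, sfInd H s a * gaussWeight β H a) :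
    NeZero ((volume.restrict (smallField H s)).withDensity fun a => ENNReal.ofReal (gaussWeight β H a)) := by
  refine ⟨fun h0 => ?_⟩
  have h := muD_univ_toReal H hβ s
  rw [h0, measureReal_def, Measure.coe_zero, Pi.zero_apply, ENNReal.toReal_zero] at h
  linarith

/-- `μ_D`-almost every field lies in `smallField H s`. -/
theorem ae_muD_mem_smallField (β : ℝ) (s : ℝ) :
    ∀ᵐ a ∂((volume.restrict (smallField H s)).withDensity fun a => ENNReal.ofReal (gaussWeight β H a)), a ∈ smallField H s :=
  (withDensity_absolutelyContinuous _ _) (ae_restrict_mem (ChartGauss.measurableSet_smallField s))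

/-- `G` integrable against `μ_D` from `G·gaussWeight` integrable. -/
theorem integrable_muD_of {β : ℝ} (hβ : 0 < β) (s : ℝ) {G : (LandauFree H → E3) → ℝ}
    (hG : Integrable fun a => G a * gaussWeight β H a) :
    Integrable G ((volume.restrict (smallField H s)).withDensity fun a => ENNReal.ofReal (gaussWeight β H a)) := by
  have hw : AEMeasurable (fun a : LandauFree H → E3 => ENNReal.ofReal (gaussWeight β H a)) (volume.restrict (smallField H s)) :=
    (EdgeChartGaussian.aestronglyMeasurable_gaussWeight H hβ).aemeasurable.ennreal_ofReal.restrict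
  refine (integrable_withDensity_iff_integrable_smul₀' hw (Filter.Eventually.of_forall fun _ => ENNReal.ofReal_lt_top)).2 ?_
  refine (hG.restrict (s := smallField H s)).congr (Filter.Eventually.of_forall fun a => ?_)
  show G a * gaussWeight β H a = (ENNReal.ofReal (gaussWeight β H a)).toReal • G a
  rw [ENNReal.toReal_ofReal (EdgeChartGaussian.gaussWeight_pos β H a).le, smul_eq_mul, mul_comm]

/-! ## The tilted expectation in `gaussAvg` letters -/

/-- **`E_t[G] = gaussAvg β H (sfInd·G·e^{tU}) / gaussAvg β H (sfInd·e^{tU})`** over `μ_D`. -/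
theorem tiltExp_muD_eq_ratio {β : ℝ} (hβ : 0 < β) (s : ℝ) (U : (LandauFree H → E3) → ℝ) (t : ℝ) (G : (LandauFree H → E3) → ℝ) :
    tiltExp ((volume.restrict (smallField H s)).withDensity fun a => ENNReal.ofReal (gaussWeight β H a)) U t G =
      gaussAvg β H (fun a => sfInd H s a * (G a * Real.exp (t * U a))) /
        gaussAvg β H (fun a => sfInd H s a * Real.exp (t * U a)) := by
  have hZ := EdgeChartGaussian.integral_gaussWeight_pos H hβ
  unfold tiltExp gaussAvg
  rw [integral_muD_eq H hβ, integral_muD_eq H hβ, div_div_div_cancel_right₀ hZ.ne']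
  congr 1 <;> refine integral_congr_ae (Filter.Eventually.of_forall fun a => ?_) <;> ring

/-- ★ **NORM TRANSFER in `gaussAvg` letters, upper**: for `0 ≤ G` with `G·gaussWeight` integrable, `|U| ≤ B` on `smallField H s`, `U` measurable,
`0 ≤ t` and `0 < ∫ sfInd·gaussWeight`:  `E_t[G] ≤ e^{2tB} · gaussAvg β H (sfInd H s · G) / gaussAvg β H (sfInd H s)`. -/
theorem tiltExp_muD_le_gaussAvg {β : ℝ} (hβ : 0 < β) {s : ℝ} (hD : 0 < ∫ a, sfInd H s a * gaussWeight β H a)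
    {U G : (LandauFree H → E3) → ℝ} {B t : ℝ} (ht : 0 ≤ t) (hU : Measurable U) (hUb : ∀ a ∈ smallField H s, |U a| ≤ B)
    (hG0 : 0 ≤ G) (hG : Integrable fun a => G a * gaussWeight β H a) :
    tiltExp ((volume.restrict (smallField H s)).withDensity fun a => ENNReal.ofReal (gaussWeight β H a)) U t G ≤
      Real.exp (2 * t * B) * (gaussAvg β H (fun a => sfInd H s a * G a) / gaussAvg β H (sfInd H s)) := by
  haveI := isFiniteMeasure_muD H hβ s
  haveI := neZero_muD H hβ hD
  have hZ := EdgeChartGaussian.integral_gaussWeight_pos H hβ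
  have hUb' : ∀ᵐ a ∂((volume.restrict (smallField H s)).withDensity fun a => ENNReal.ofReal (gaussWeight β H a)), |U a| ≤ B := by
    filter_upwards [ae_muD_mem_smallField H β s] with a ha using hUb a ha
  have h := tiltExp_le_of_nonneg (μ := (volume.restrict (smallField H s)).withDensity fun a => ENNReal.ofReal (gaussWeight β H a))
    ht hU.aemeasurable hUb' hG0 (integrable_muD_of H hβ s hG)
  rw [integral_muD_eq H hβ, muD_univ_toReal H hβ] at h
  refine h.trans (le_of_eq ?_)
  congr 1
  unfold gaussAvg
  rw [div_div_div_cancel_right₀ hZ.ne']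
  congr 1
  refine integral_congr_ae (Filter.Eventually.of_forall fun a => ?_)
  ring

/-- ★ **NORM TRANSFER in `gaussAvg` letters, lower**: `e^{−2tB} · gaussAvg β H (sfInd·G) / gaussAvg β H (sfInd) ≤ E_t[G]`
(`0 ≤ G` with `G·e^{tU}·gaussWeight` and `G·gaussWeight` integrable). -/
theorem tiltExp_muD_ge_gaussAvg {β : ℝ} (hβ : 0 < β) {s : ℝ} (hD : 0 < ∫ a, sfInd H s a * gaussWeight β H a)
    {U G : (LandauFree H → E3) → ℝ} {B t : ℝ} (ht : 0 ≤ t) (hU : Measurable U) (hUb : ∀ a ∈ smallField H s, |U a| ≤ B)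
    (hG0 : 0 ≤ G) (hGe : Integrable fun a => G a * Real.exp (t * U a) * gaussWeight β H a) :
    Real.exp (-(2 * t * B)) * (gaussAvg β H (fun a => sfInd H s a * G a) / gaussAvg β H (sfInd H s)) ≤
      tiltExp ((volume.restrict (smallField H s)).withDensity fun a => ENNReal.ofReal (gaussWeight β H a)) U t G := by
  haveI := isFiniteMeasure_muD H hβ s
  haveI := neZero_muD H hβ hD
  have hZ := EdgeChartGaussian.integral_gaussWeight_pos H hβ
  have hUb' : ∀ᵐ a ∂((volume.restrict (smallField H s)).withDensity fun a => ENNReal.ofReal (gaussWeight β H a)), |U a| ≤ B := by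
    filter_upwards [ae_muD_mem_smallField H β s] with a ha using hUb a ha
  have h := tiltExp_ge_of_nonneg (μ := (volume.restrict (smallField H s)).withDensity fun a => ENNReal.ofReal (gaussWeight β H a))
    ht hU.aemeasurable hUb' hG0 (integrable_muD_of H hβ s hGe)
  rw [integral_muD_eq H hβ, muD_univ_toReal H hβ] at h
  refine le_trans (le_of_eq ?_) h
  congr 1
  unfold gaussAvg
  rw [div_div_div_cancel_right₀ hZ.ne']
  congr 1
  refine integral_congr_ae (Filter.Eventually.of_forall fun a => ?_)
  ring

end Tilt

end Summit.QuantumFields.YangMills.Theorems.AllWindowsColdBoxBoxHighLine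

end
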